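import Literature.Analysis.FluidPDE.HardSphereDynamicsProofs
import HarnessLib

/-!
# The dispersion inequality for hard spheres in `ℝ^d` (CIP 1994 Lemma 4.2.3)

Topic: MathematicalPhysics / KineticTheory. A brick of the BBGKY side of the convergence half of
the named fact `Literature.MathematicalPhysics.KineticTheory.illner_pulvirenti` (global validity
of the Boltzmann equation for a rare gas cloud in all space; Cercignani–Illner–Pulvirenti 1994
Thm 4.5.1): the only property of the interacting hard-sphere flow, beyond conservation of
energy, that the global estimates of CIP §4.5 use ((5.3): `I(T_σ^{-t} z) ≤ …`, via Lemma 4.3.2 =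
Lemma 4.2.3–4.2.4 of §4.2).

**Lemma 4.2.3** (CIP 1994 p. 66–67). *For hard spheres in all of `ℝ³`, `I(T_t z) ≥ I(T⁰_t z)`
for `t ≥ 0`, where `I(z) = ∑ |x_i|²` and `T⁰` is the free flow.* Proof (p. 67): between
collisions `I(T_t z) = I(T⁰_{t-t_k}(T_{t_k} z))`, and at a collision of the pair `k, k'` at
positions `y_k, y_k'` with incoming velocities `η` and outgoing `ζ`,
`y_k·ζ_k + y_k'·ζ_k' = y_k·η_k + y_k'·η_k' + σ n_k·(η_k - η_k')`, so that
`I(T_t z) = I(T⁰_{t-t_k}(T_{t_k} z)⁻) + 2σ(t - t_k) n_k·(η_k - η_k')` with `n_k·(η_k - η_k') ≥ 0`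
for an incoming pair; "repeated application of this calculation leads to the assertion."

This file proves it for hard-sphere trajectories in `ℝ^d` in the sense of the tree
(`Literature.Analysis.FluidPDE.IsHardSphereTrajectory` for `Euclidean.geometry d`: locally
finitely many collision times, free flight in between, binary elastic collisions from incoming
left limits):

* `sum_norm_sq_add_smul_collidePair` — the collision identity: for the elastic reflection of the
  pair `(i, j)`,
  `∑_k |x_k' + r v_k'|² = ∑_k |x_k + r v_k|² - 2 r ⟨x_i - x_j, v_i - v_j⟩`
  (so the jump is `≥ 0` for an incoming pair and `r ≥ 0`);
* `IsHardSphereTrajectory.sum_norm_sq_add_smul_mono` — along a trajectory the backward-free-flight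
  moment of inertia `M_{t'}(s) = ∑_k |x_k(s) + (t' - s) v_k(s)|² = I(T⁰_{t'-s} γ(s))` is
  nondecreasing in `s ≤ t'` (induction on the finitely many collision times in `(a, b]`);
* `IsHardSphereTrajectory.sum_norm_sq_freeFlight_le` — **Lemma 4.2.3**: for `0 ≤ t`,
  `∑_k |x_k(0) + t v_k(0)|² ≤ ∑_k |x_k(t)|²`, i.e. `I(T⁰_t γ(0)) ≤ I(γ(t))`.

Theorems only; any dimension.

## References

* C. Cercignani, R. Illner, M. Pulvirenti, *The Mathematical Theory of Dilute Gases*, Applied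
  Mathematical Sciences 106, Springer (1994), §4.2, Lemma 4.2.3 and its proof, pp. 66–67
  (PDF pp. 74–75 of the held copy); used in §4.5 (5.3) through Lemma 4.3.2.
-/

open Set Filter Topology Function
open scoped InnerProductSpace

namespace Literature.MathematicalPhysics.KineticTheory

noncomputable section

open Literature.Analysis.FluidPDE

variable {d : Type*} [Fintype d] {N : ℕ}


/-! ## The collision identity -/

/-- **The elastic collision identity behind the dispersion inequality** (CIP 1994, proof of
Lemma 4.2.3, p. 67): if the pair `(i, j)` of the configuration `z` undergoes the elastic
reflection `collidePair` (positions unchanged, `v_i' = v_i - c n`, `v_j' = v_j + c n`,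
`n = x_i - x_j`, `c = ⟨v_i - v_j, n⟩/|n|²`), then for every real `r`
`∑_k |x_k' + r v_k'|² = ∑_k |x_k + r v_k|² - 2 r ⟨x_i - x_j, v_i - v_j⟩`
(momentum and energy are conserved, so only the cross term `2r ∑ ⟨x_k, v_k⟩` changes, by
`2r ⟨x_i - x_j, v_i' - v_i⟩ = -2rc|n|² = -2r⟨n, v_i - v_j⟩`). [cite: CIP1994, §4.2 Lemma 4.2.3 (proof, p. 67)] -/
theorem sum_norm_sq_add_smul_collidePair (z : Config N d (EuclideanSpace ℝ d)) {i j : Fin N} (hij : i ≠ j) (r : ℝ) :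
    ∑ k, ‖(collidePair (Euclidean.geometry d) i j z k).1 +
        r • (collidePair (Euclidean.geometry d) i j z k).2‖ ^ 2 =
      (∑ k, ‖(z k).1 + r • (z k).2‖ ^ 2) - 2 * r * ⟪(z i).1 - (z j).1, (z i).2 - (z j).2⟫_ℝ := by
  classical
  set n : (EuclideanSpace ℝ d) := (z i).1 - (z j).1 with hn
  set c : ℝ := ⟪(z i).2 - (z j).2, n⟫_ℝ / ‖n‖ ^ 2 with hc
  set f : (EuclideanSpace ℝ d) × (EuclideanSpace ℝ d) → ℝ := fun p => ‖p.1 + r • p.2‖ ^ 2 with hf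
  -- the reflected configuration
  have hi : collidePair (Euclidean.geometry d) i j z i = ((z i).1, (z i).2 - c • n) := by
    rw [collidePair_apply_left hij]
    simp only [reflectVel, Euclidean.geometry_sepVec, hc, hn]
  have hj : collidePair (Euclidean.geometry d) i j z j = ((z j).1, (z j).2 + c • n) := by
    rw [collidePair_apply_right]
    simp only [reflectVel, Euclidean.geometry_sepVec, hc, hn]
  have hk : ∀ k, k ≠ i → k ≠ j → collidePair (Euclidean.geometry d) i j z k = z k :=
    fun k hki hkj => collidePair_apply_of_ne hki hkj z
  -- `c |n|² = ⟨v_i - v_j, n⟩` (also when `n = 0`)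
  have hcn : c * ‖n‖ ^ 2 = ⟪(z i).2 - (z j).2, n⟫_ℝ := by
    by_cases hn0 : n = 0
    · simp [hn0]
    · have : ‖n‖ ^ 2 ≠ 0 := pow_ne_zero 2 (norm_ne_zero_iff.2 hn0)
      rw [hc, div_mul_cancel₀ _ this]
  -- the difference of the two sums is supported on `{i, j}`
  have hsum : ∑ k, (f (collidePair (Euclidean.geometry d) i j z k) - f (z k)) =
      (f (collidePair (Euclidean.geometry d) i j z i) - f (z i)) +
        (f (collidePair (Euclidean.geometry d) i j z j) - f (z j)) :=
    Finset.sum_eq_add_of_mem i j (Finset.mem_univ _) (Finset.mem_univ _) hij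
      fun k _ hk' => by rw [hk k hk'.1 hk'.2, sub_self]
  have hsplit : ∑ k, f (collidePair (Euclidean.geometry d) i j z k) =
      (∑ k, f (z k)) + ∑ k, (f (collidePair (Euclidean.geometry d) i j z k) - f (z k)) := by
    rw [Finset.sum_sub_distrib]; ring
  -- the two changed terms
  set wi : (EuclideanSpace ℝ d) := (z i).1 + r • (z i).2 with hwi
  set wj : (EuclideanSpace ℝ d) := (z j).1 + r • (z j).2 with hwj
  have hfi : f (collidePair (Euclidean.geometry d) i j z i) - f (z i) =
      -2 * (r * c) * ⟪wi, n⟫_ℝ + (r * c) ^ 2 * ‖n‖ ^ 2 := by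
    have e : (z i).1 + r • ((z i).2 - c • n) = wi - (r * c) • n := by
      simp only [hwi, smul_sub, smul_smul]
      abel
    simp only [hf, hi]
    rw [e, norm_sub_sq_real, inner_smul_right, norm_smul, mul_pow, Real.norm_eq_abs, sq_abs]
    ring
  have hfj : f (collidePair (Euclidean.geometry d) i j z j) - f (z j) =
      2 * (r * c) * ⟪wj, n⟫_ℝ + (r * c) ^ 2 * ‖n‖ ^ 2 := by
    have e : (z j).1 + r • ((z j).2 + c • n) = wj + (r * c) • n := by
      simp only [hwj, smul_add, smul_smul]
      abel
    simp only [hf, hj]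
    rw [e, norm_add_sq_real, inner_smul_right, norm_smul, mul_pow, Real.norm_eq_abs, sq_abs]
    ring
  have hw : ⟪wi, n⟫_ℝ - ⟪wj, n⟫_ℝ = ‖n‖ ^ 2 + r * ⟪(z i).2 - (z j).2, n⟫_ℝ := by
    have e : wi - wj = n + r • ((z i).2 - (z j).2) := by
      simp only [hwi, hwj, hn, smul_sub]
      abel
    rw [← inner_sub_left, e, inner_add_left, inner_smul_left, real_inner_self_eq_norm_sq]
    simp
  have hcomm : ⟪(z i).1 - (z j).1, (z i).2 - (z j).2⟫_ℝ = ⟪(z i).2 - (z j).2, n⟫_ℝ := by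
    rw [hn, real_inner_comm]
  show ∑ k, f (collidePair (Euclidean.geometry d) i j z k) = (∑ k, f (z k)) - _
  rw [hsplit, hsum, hfi, hfj, hcomm]
  linear_combination (-2 * r * c) * hw + (2 * r ^ 2 * c - 2 * r) * hcn

/-- For an incoming pair (`⟨x_i - x_j, v_i - v_j⟩ < 0`) and `r ≥ 0` the collision does not
decrease `∑_k |x_k + r v_k|²`. [cite: CIP1994, §4.2 Lemma 4.2.3 (proof, p. 67)] -/
theorem sum_norm_sq_add_smul_le_collidePair (z : Config N d (EuclideanSpace ℝ d)) {i j : Fin N} (hij : i ≠ j)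
    (hin : IsIncoming (Euclidean.geometry d) z i j) {r : ℝ} (hr : 0 ≤ r) :
    ∑ k, ‖(z k).1 + r • (z k).2‖ ^ 2 ≤
      ∑ k, ‖(collidePair (Euclidean.geometry d) i j z k).1 +
        r • (collidePair (Euclidean.geometry d) i j z k).2‖ ^ 2 := by
  rw [sum_norm_sq_add_smul_collidePair z hij r]
  have h : ⟪(z i).1 - (z j).1, (z i).2 - (z j).2⟫_ℝ < 0 := hin
  nlinarith [mul_nonneg hr (neg_nonneg.2 h.le)]

/-! ## Along a trajectory -/

/-- Free flight does not change `x + (t' - s) v` when `s` advances with the flight: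
`∑_k |x_k(S_u z) + (t' - (s + u)) v_k|² = ∑_k |x_k(z) + (t' - s) v_k(z)|²`. [folklore] -/
theorem sum_norm_sq_add_smul_freeFlight (z : Config N d (EuclideanSpace ℝ d)) (t' s u : ℝ) :
    ∑ k, ‖(freeFlight (Euclidean.geometry d) u z k).1 +
        (t' - (s + u)) • (freeFlight (Euclidean.geometry d) u z k).2‖ ^ 2 =
      ∑ k, ‖(z k).1 + (t' - s) • (z k).2‖ ^ 2 := by
  refine Finset.sum_congr rfl fun k _ => ?_
  simp only [freeFlight_apply, Euclidean.geometry_translate]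
  congr 2
  rw [add_assoc, ← add_smul]
  congr 2
  ring

/-- On a stretch `[a, b]` without collision times in `(a, b]` the backward-free-flight moment of
inertia is unchanged: `M_{t'}(b) = M_{t'}(a)`. [folklore] -/
theorem _root_.Literature.Analysis.FluidPDE.IsHardSphereTrajectory.sum_norm_sq_add_smul_eq_of_free {ε : ℝ} {γ : ℝ → Config N d (EuclideanSpace ℝ d)}
    (h : IsHardSphereTrajectory (Euclidean.geometry d) ε N γ) {a b : ℝ} (hab : a ≤ b)
    (hfree : ∀ τ ∈ Ioc a b, τ ∉ collisionTimes (Euclidean.geometry d) ε γ) (t' : ℝ) :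
    ∑ k, ‖(γ b k).1 + (t' - b) • (γ b k).2‖ ^ 2 = ∑ k, ‖(γ a k).1 + (t' - a) • (γ a k).2‖ ^ 2 := by
  rw [h.free a b hab hfree]
  have := sum_norm_sq_add_smul_freeFlight (γ a) t' a (b - a)
  rwa [add_sub_cancel] at this

/-- **Monotonicity of the backward-free-flight moment of inertia along a hard-sphere trajectory
in `ℝ^d`** (CIP 1994 Lemma 4.2.3, "repeated application"): for `a ≤ b ≤ t'`,
`∑_k |x_k(a) + (t' - a) v_k(a)|² ≤ ∑_k |x_k(b) + (t' - b) v_k(b)|²`. Induction on the number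
of collision times in `(a, b]`: between collisions the quantity is constant
(`sum_norm_sq_add_smul_eq_of_free`), and at the last collision time `c ≤ b` the value jumps up
from its left limit (the free-flight value from any earlier collision-free time,
`leftLim_eq_freeFlight`) by `-2 (t' - c) ⟨x_i - x_j, v_i⁻ - v_j⁻⟩ ≥ 0`
(`sum_norm_sq_add_smul_le_collidePair`, the left limit being incoming).
[cite: CIP1994, §4.2 Lemma 4.2.3] -/
theorem _root_.Literature.Analysis.FluidPDE.IsHardSphereTrajectory.sum_norm_sq_add_smul_mono {ε : ℝ} {γ : ℝ → Config N d (EuclideanSpace ℝ d)}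
    (h : IsHardSphereTrajectory (Euclidean.geometry d) ε N γ)
    {t' a b : ℝ} (hab : a ≤ b) (hbt : b ≤ t') :
    ∑ k, ‖(γ a k).1 + (t' - a) • (γ a k).2‖ ^ 2 ≤ ∑ k, ‖(γ b k).1 + (t' - b) • (γ b k).2‖ ^ 2 := by
  classical
  have hG : ∀ x : (EuclideanSpace ℝ d), Continuous ((Euclidean.geometry d).translate x) := fun x =>
    (continuous_const.add continuous_id : Continuous fun v : (EuclideanSpace ℝ d) => x + v)
  -- the finite set of collision times in `(a, b]`
  have hfin : ∀ a b : ℝ, (collisionTimes (Euclidean.geometry d) ε γ ∩ Ioc a b).Finite := fun a b =>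
    (h.locFinite a b).subset (inter_subset_inter_right _ Ioc_subset_Icc_self)
  -- induction on the number of collision times in `(a, b]`
  suffices key : ∀ (n : ℕ) (a b : ℝ), (hfin a b).toFinset.card ≤ n → a ≤ b → b ≤ t' →
      ∑ k, ‖(γ a k).1 + (t' - a) • (γ a k).2‖ ^ 2 ≤ ∑ k, ‖(γ b k).1 + (t' - b) • (γ b k).2‖ ^ 2 from
    key _ a b le_rfl hab hbt
  intro n
  induction n with
  | zero =>
    intro a b hcard hab _
    have hempty : ∀ τ ∈ Ioc a b, τ ∉ collisionTimes (Euclidean.geometry d) ε γ := by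
      intro τ hτ hcol
      have hmem : τ ∈ (hfin a b).toFinset := by
        rw [Set.Finite.mem_toFinset]; exact ⟨hcol, hτ⟩
      have : 0 < (hfin a b).toFinset.card := Finset.card_pos.2 ⟨τ, hmem⟩
      omega
    exact (h.sum_norm_sq_add_smul_eq_of_free hab hempty t').ge
  | succ n ih =>
    intro a b hcard hab hbt
    by_cases hC : (hfin a b).toFinset.Nonempty
    swap
    · -- no collision in `(a, b]`
      rw [Finset.not_nonempty_iff_eq_empty] at hC
      have hempty : ∀ τ ∈ Ioc a b, τ ∉ collisionTimes (Euclidean.geometry d) ε γ := by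
        intro τ hτ hcol
        have hmem : τ ∈ (hfin a b).toFinset := by
          rw [Set.Finite.mem_toFinset]; exact ⟨hcol, hτ⟩
        rw [hC] at hmem
        exact absurd hmem (Finset.notMem_empty τ)
      exact (h.sum_norm_sq_add_smul_eq_of_free hab hempty t').ge
    -- the last collision time `c ∈ (a, b]`
    set c : ℝ := (hfin a b).toFinset.max' hC with hc_def
    have hcmem : c ∈ (hfin a b).toFinset := Finset.max'_mem _ hC
    rw [Set.Finite.mem_toFinset] at hcmem
    obtain ⟨hccol, hac, hcb⟩ := hcmem
    have hmax : ∀ τ ∈ (hfin a b).toFinset, τ ≤ c := fun τ hτ => Finset.le_max' _ τ hτ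
    -- after `c`: no collision in `(c, b]`
    have hfree_cb : ∀ τ ∈ Ioc c b, τ ∉ collisionTimes (Euclidean.geometry d) ε γ := by
      intro τ hτ hcol
      have hmem : τ ∈ (hfin a b).toFinset := by
        rw [Set.Finite.mem_toFinset]; exact ⟨hcol, hac.trans hτ.1, hτ.2⟩
      exact absurd (hmax τ hmem) (not_le.2 hτ.1)
    have h3 : ∑ k, ‖(γ b k).1 + (t' - b) • (γ b k).2‖ ^ 2 =
        ∑ k, ‖(γ c k).1 + (t' - c) • (γ c k).2‖ ^ 2 :=
      h.sum_norm_sq_add_smul_eq_of_free hcb hfree_cb t'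
    -- just before `c`: a collision-free interval `(s₀, c)`, and a time `s ∈ [a, c)` in it
    obtain ⟨s₀, hs₀c, hfree_s₀c⟩ := h.exists_Ioo_left_free c
    set s : ℝ := max a ((s₀ + c) / 2) with hs_def
    have has : a ≤ s := le_max_left _ _
    have hsc : s < c := max_lt hac (by linarith)
    have hs₀s : s₀ < s := lt_of_lt_of_le (by linarith) (le_max_right _ _)
    have hfree_sc : ∀ σ ∈ Ioo s c, σ ∉ collisionTimes (Euclidean.geometry d) ε γ :=
      fun σ hσ => hfree_s₀c σ ⟨hs₀s.trans hσ.1, hσ.2⟩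
    -- the jump at `c` is nonnegative
    have h2 : ∑ k, ‖(γ s k).1 + (t' - s) • (γ s k).2‖ ^ 2 ≤
        ∑ k, ‖(γ c k).1 + (t' - c) • (γ c k).2‖ ^ 2 := by
      obtain ⟨i, j, hij, hcontact⟩ := hccol
      obtain ⟨hin, heq⟩ := h.eq_collidePair_leftLim hij hcontact
      have hzl : leftLim γ c = freeFlight (Euclidean.geometry d) (c - s) (γ s) :=
        h.leftLim_eq_freeFlight hG hsc hfree_sc
      have hr : 0 ≤ t' - c := by linarith
      calc ∑ k, ‖(γ s k).1 + (t' - s) • (γ s k).2‖ ^ 2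
          = ∑ k, ‖(leftLim γ c k).1 + (t' - c) • (leftLim γ c k).2‖ ^ 2 := by
            rw [hzl]
            have := sum_norm_sq_add_smul_freeFlight (γ s) t' s (c - s)
            rw [add_sub_cancel] at this
            exact this.symm
        _ ≤ ∑ k, ‖(collidePair (Euclidean.geometry d) i j (leftLim γ c) k).1 +
              (t' - c) • (collidePair (Euclidean.geometry d) i j (leftLim γ c) k).2‖ ^ 2 :=
            sum_norm_sq_add_smul_le_collidePair _ hij hin hr
        _ = ∑ k, ‖(γ c k).1 + (t' - c) • (γ c k).2‖ ^ 2 := by rw [← heq]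
    -- before `s`: fewer collision times in `(a, s]`, induction
    have hcard' : (hfin a s).toFinset.card ≤ n := by
      have hsub : (hfin a s).toFinset ⊆ ((hfin a b).toFinset).erase c := by
        intro τ hτ
        rw [Set.Finite.mem_toFinset] at hτ
        refine Finset.mem_erase.2 ⟨?_, ?_⟩
        · exact fun e => absurd (e ▸ hτ.2.2 : c ≤ s) (not_le.2 hsc)
        · rw [Set.Finite.mem_toFinset]
          exact ⟨hτ.1, hτ.2.1, hτ.2.2.trans (hsc.le.trans hcb)⟩
      have hcmem' : c ∈ (hfin a b).toFinset := Finset.max'_mem _ hC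
      have := Finset.card_le_card hsub
      rw [Finset.card_erase_of_mem hcmem'] at this
      omega
    have h1 := ih a s hcard' has (hsc.le.trans (hcb.trans hbt))
    -- chain
    calc ∑ k, ‖(γ a k).1 + (t' - a) • (γ a k).2‖ ^ 2
        ≤ ∑ k, ‖(γ s k).1 + (t' - s) • (γ s k).2‖ ^ 2 := h1
      _ ≤ ∑ k, ‖(γ c k).1 + (t' - c) • (γ c k).2‖ ^ 2 := h2
      _ = ∑ k, ‖(γ b k).1 + (t' - b) • (γ b k).2‖ ^ 2 := h3.symm

/-- **CIP 1994 Lemma 4.2.3: the dispersion inequality for hard spheres in `ℝ^d`.** Along a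
hard-sphere trajectory `γ` in the whole space, for `t ≥ 0`,
`∑_k |x_k(0) + t v_k(0)|² ≤ ∑_k |x_k(t)|²`, i.e. `I(T⁰_t γ(0)) ≤ I(γ(t))` with
`I(z) = ∑ |x_k|²`: elastic collisions can only increase the spreading of the cloud. ("Parts 2
and 3 of Lemma 4.2.2, Lemma 4.2.3, and Lemma 4.2.4 are in general wrong if `Λ ≠ ℝ³`", CIP
p. 67: the whole space is essential.) [cite: CIP1994, §4.2 Lemma 4.2.3] -/
theorem _root_.Literature.Analysis.FluidPDE.IsHardSphereTrajectory.sum_norm_sq_freeFlight_le {ε : ℝ} {γ : ℝ → Config N d (EuclideanSpace ℝ d)}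
    (h : IsHardSphereTrajectory (Euclidean.geometry d) ε N γ) {t : ℝ} (ht : 0 ≤ t) :
    ∑ k, ‖(γ 0 k).1 + t • (γ 0 k).2‖ ^ 2 ≤ ∑ k, ‖(γ t k).1‖ ^ 2 := by
  have hmono := h.sum_norm_sq_add_smul_mono (t' := t) ht le_rfl
  simp only [sub_zero, sub_self, zero_smul, add_zero] at hmono
  exact hmono

/-- The same inequality between any two times `s ≤ t`:
`∑_k |x_k(s) + (t - s) v_k(s)|² ≤ ∑_k |x_k(t)|²` (CIP 1994 Lemma 4.2.3 along the trajectory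
restarted at time `s`). [cite: CIP1994, §4.2 Lemma 4.2.3] -/
theorem _root_.Literature.Analysis.FluidPDE.IsHardSphereTrajectory.sum_norm_sq_freeFlight_le_of_le {ε : ℝ} {γ : ℝ → Config N d (EuclideanSpace ℝ d)}
    (h : IsHardSphereTrajectory (Euclidean.geometry d) ε N γ) {s t : ℝ} (hst : s ≤ t) :
    ∑ k, ‖(γ s k).1 + (t - s) • (γ s k).2‖ ^ 2 ≤ ∑ k, ‖(γ t k).1‖ ^ 2 := by
  have hmono := h.sum_norm_sq_add_smul_mono (t' := t) hst le_rfl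
  simp only [sub_self, zero_smul, add_zero] at hmono
  exact hmono

/-! ## The backward version (CIP 1994 Lemma 4.2.4) -/

/-- For an incoming pair and `r ≤ 0` the collision does not INCREASE `∑_k |x_k + r v_k|²` (the
jump `-2r⟨x_i - x_j, v_i - v_j⟩` is now `≤ 0`). [cite: CIP1994, §4.2 Lemma 4.2.4] -/
theorem sum_norm_sq_add_smul_collidePair_le (z : Config N d (EuclideanSpace ℝ d)) {i j : Fin N}
    (hij : i ≠ j) (hin : IsIncoming (Euclidean.geometry d) z i j) {r : ℝ} (hr : r ≤ 0) :
    ∑ k, ‖(collidePair (Euclidean.geometry d) i j z k).1 +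
        r • (collidePair (Euclidean.geometry d) i j z k).2‖ ^ 2 ≤
      ∑ k, ‖(z k).1 + r • (z k).2‖ ^ 2 := by
  rw [sum_norm_sq_add_smul_collidePair z hij r]
  have h : ⟪(z i).1 - (z j).1, (z i).2 - (z j).2⟫_ℝ < 0 := hin
  nlinarith [mul_nonneg (neg_nonneg.2 hr) (neg_nonneg.2 h.le)]

/-- **Antitonicity past the reference time** (CIP 1994 Lemma 4.2.4, the case `s, t ≤ 0`): for
`t' ≤ a ≤ b`, `∑_k |x_k(b) + (t' - b) v_k(b)|² ≤ ∑_k |x_k(a) + (t' - a) v_k(a)|²` along a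
hard-sphere trajectory in `ℝ^d` — now `t' - c ≤ 0` at every collision time `c ∈ (a, b]`, so the
jumps are nonpositive (`sum_norm_sq_add_smul_collidePair_le`); same induction as
`sum_norm_sq_add_smul_mono`. In the notation of CIP: `I(T⁰_s T_t z) ≥ I(T⁰_{t+s} z)` for
`s, t ≤ 0`. [cite: CIP1994, §4.2 Lemma 4.2.4] -/
theorem _root_.Literature.Analysis.FluidPDE.IsHardSphereTrajectory.sum_norm_sq_add_smul_anti {ε : ℝ} {γ : ℝ → Config N d (EuclideanSpace ℝ d)}
    (h : IsHardSphereTrajectory (Euclidean.geometry d) ε N γ)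
    {t' a b : ℝ} (hta : t' ≤ a) (hab : a ≤ b) :
    ∑ k, ‖(γ b k).1 + (t' - b) • (γ b k).2‖ ^ 2 ≤ ∑ k, ‖(γ a k).1 + (t' - a) • (γ a k).2‖ ^ 2 := by
  classical
  have hG : ∀ x : (EuclideanSpace ℝ d), Continuous ((Euclidean.geometry d).translate x) := fun x =>
    (continuous_const.add continuous_id : Continuous fun v : (EuclideanSpace ℝ d) => x + v)
  have hfin : ∀ a b : ℝ, (collisionTimes (Euclidean.geometry d) ε γ ∩ Ioc a b).Finite := fun a b =>
    (h.locFinite a b).subset (inter_subset_inter_right _ Ioc_subset_Icc_self)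
  suffices key : ∀ (n : ℕ) (a b : ℝ), (hfin a b).toFinset.card ≤ n → t' ≤ a → a ≤ b →
      ∑ k, ‖(γ b k).1 + (t' - b) • (γ b k).2‖ ^ 2 ≤ ∑ k, ‖(γ a k).1 + (t' - a) • (γ a k).2‖ ^ 2 from
    key _ a b le_rfl hta hab
  intro n
  induction n with
  | zero =>
    intro a b hcard _ hab
    have hempty : ∀ τ ∈ Ioc a b, τ ∉ collisionTimes (Euclidean.geometry d) ε γ := by
      intro τ hτ hcol
      have hmem : τ ∈ (hfin a b).toFinset := by
        rw [Set.Finite.mem_toFinset]; exact ⟨hcol, hτ⟩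
      have : 0 < (hfin a b).toFinset.card := Finset.card_pos.2 ⟨τ, hmem⟩
      omega
    exact (h.sum_norm_sq_add_smul_eq_of_free hab hempty t').le
  | succ n ih =>
    intro a b hcard hta hab
    by_cases hC : (hfin a b).toFinset.Nonempty
    swap
    · rw [Finset.not_nonempty_iff_eq_empty] at hC
      have hempty : ∀ τ ∈ Ioc a b, τ ∉ collisionTimes (Euclidean.geometry d) ε γ := by
        intro τ hτ hcol
        have hmem : τ ∈ (hfin a b).toFinset := by
          rw [Set.Finite.mem_toFinset]; exact ⟨hcol, hτ⟩
        rw [hC] at hmem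
        exact absurd hmem (Finset.notMem_empty τ)
      exact (h.sum_norm_sq_add_smul_eq_of_free hab hempty t').le
    -- the last collision time `c ∈ (a, b]`
    set c : ℝ := (hfin a b).toFinset.max' hC with hc_def
    have hcmem : c ∈ (hfin a b).toFinset := Finset.max'_mem _ hC
    rw [Set.Finite.mem_toFinset] at hcmem
    obtain ⟨hccol, hac, hcb⟩ := hcmem
    have hmax : ∀ τ ∈ (hfin a b).toFinset, τ ≤ c := fun τ hτ => Finset.le_max' _ τ hτ
    have hfree_cb : ∀ τ ∈ Ioc c b, τ ∉ collisionTimes (Euclidean.geometry d) ε γ := by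
      intro τ hτ hcol
      have hmem : τ ∈ (hfin a b).toFinset := by
        rw [Set.Finite.mem_toFinset]; exact ⟨hcol, hac.trans hτ.1, hτ.2⟩
      exact absurd (hmax τ hmem) (not_le.2 hτ.1)
    have h3 : ∑ k, ‖(γ b k).1 + (t' - b) • (γ b k).2‖ ^ 2 =
        ∑ k, ‖(γ c k).1 + (t' - c) • (γ c k).2‖ ^ 2 :=
      h.sum_norm_sq_add_smul_eq_of_free hcb hfree_cb t'
    obtain ⟨s₀, hs₀c, hfree_s₀c⟩ := h.exists_Ioo_left_free c
    set s : ℝ := max a ((s₀ + c) / 2) with hs_def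
    have has : a ≤ s := le_max_left _ _
    have hsc : s < c := max_lt hac (by linarith)
    have hs₀s : s₀ < s := lt_of_lt_of_le (by linarith) (le_max_right _ _)
    have hfree_sc : ∀ σ ∈ Ioo s c, σ ∉ collisionTimes (Euclidean.geometry d) ε γ :=
      fun σ hσ => hfree_s₀c σ ⟨hs₀s.trans hσ.1, hσ.2⟩
    -- the jump at `c` is nonpositive
    have h2 : ∑ k, ‖(γ c k).1 + (t' - c) • (γ c k).2‖ ^ 2 ≤
        ∑ k, ‖(γ s k).1 + (t' - s) • (γ s k).2‖ ^ 2 := by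
      obtain ⟨i, j, hij, hcontact⟩ := hccol
      obtain ⟨hin, heq⟩ := h.eq_collidePair_leftLim hij hcontact
      have hzl : leftLim γ c = freeFlight (Euclidean.geometry d) (c - s) (γ s) :=
        h.leftLim_eq_freeFlight hG hsc hfree_sc
      have hr : t' - c ≤ 0 := by linarith
      calc ∑ k, ‖(γ c k).1 + (t' - c) • (γ c k).2‖ ^ 2
          = ∑ k, ‖(collidePair (Euclidean.geometry d) i j (leftLim γ c) k).1 +
              (t' - c) • (collidePair (Euclidean.geometry d) i j (leftLim γ c) k).2‖ ^ 2 := by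
            rw [← heq]
        _ ≤ ∑ k, ‖(leftLim γ c k).1 + (t' - c) • (leftLim γ c k).2‖ ^ 2 :=
            sum_norm_sq_add_smul_collidePair_le _ hij hin hr
        _ = ∑ k, ‖(γ s k).1 + (t' - s) • (γ s k).2‖ ^ 2 := by
            rw [hzl]
            have := sum_norm_sq_add_smul_freeFlight (γ s) t' s (c - s)
            rw [add_sub_cancel] at this
            exact this
    have hcard' : (hfin a s).toFinset.card ≤ n := by
      have hsub : (hfin a s).toFinset ⊆ ((hfin a b).toFinset).erase c := by
        intro τ hτ
        rw [Set.Finite.mem_toFinset] at hτ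
        refine Finset.mem_erase.2 ⟨?_, ?_⟩
        · exact fun e => absurd (e ▸ hτ.2.2 : c ≤ s) (not_le.2 hsc)
        · rw [Set.Finite.mem_toFinset]
          exact ⟨hτ.1, hτ.2.1, hτ.2.2.trans (hsc.le.trans hcb)⟩
      have hcmem' : c ∈ (hfin a b).toFinset := Finset.max'_mem _ hC
      have := Finset.card_le_card hsub
      rw [Finset.card_erase_of_mem hcmem'] at this
      omega
    have h1 := ih a s hcard' hta has
    calc ∑ k, ‖(γ b k).1 + (t' - b) • (γ b k).2‖ ^ 2
        = ∑ k, ‖(γ c k).1 + (t' - c) • (γ c k).2‖ ^ 2 := h3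
      _ ≤ ∑ k, ‖(γ s k).1 + (t' - s) • (γ s k).2‖ ^ 2 := h2
      _ ≤ ∑ k, ‖(γ a k).1 + (t' - a) • (γ a k).2‖ ^ 2 := h1

/-- **CIP 1994 Lemma 4.2.4 (backward dispersion) for the transports of the BBGKY hierarchy in
`ℝ^d`**: for `0 ≤ τ ≤ t` and the trajectory through `γ(t)`,
`∑_k |x_k(t) - t v_k(t)|² ≤ ∑_k |x_k(τ) - τ v_k(τ)|²` — the dispersive weight `e^{-β₀ I(T⁰_{-t} ·)}`
pulled back along the interacting flow over a time span `t - τ` dominates `e^{-β₀ I(T⁰_{-τ} ·)}`;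
this is how the weight of CIP (5.4) is transported in (5.2)–(5.3). [cite: CIP1994, §4.2 Lemma 4.2.4] -/
theorem _root_.Literature.Analysis.FluidPDE.IsHardSphereTrajectory.sum_norm_sq_sub_smul_le_of_le {ε : ℝ} {γ : ℝ → Config N d (EuclideanSpace ℝ d)}
    (h : IsHardSphereTrajectory (Euclidean.geometry d) ε N γ) {τ t : ℝ} (hτ : 0 ≤ τ) (hτt : τ ≤ t) :
    ∑ k, ‖(γ t k).1 - t • (γ t k).2‖ ^ 2 ≤ ∑ k, ‖(γ τ k).1 - τ • (γ τ k).2‖ ^ 2 := by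
  have hanti := h.sum_norm_sq_add_smul_anti (t' := 0) hτ hτt
  simpa only [zero_sub, neg_smul, ← sub_eq_add_neg] using hanti

end

end Literature.MathematicalPhysics.KineticTheory
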